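import Literature.Topology.FourManifolds.MMSWPictureCollars
import HarnessLib

/-!
# The compression of the standard picture: the virtual planar point

Topic `Literature/Topology/FourManifolds`; part of the proof of the named fact
`Literature.Topology.FourManifolds.pictureSurgeryPresentation` (`MMSWPictureSurgery.lean`; Kirby,
*The Topology of 4-Manifolds*, LNM 1374 (1989), Ch. I §2, Lemma 2.1).  Everything here is proved;
no named fact is introduced.

The identification of `M_k ∖ K` with the surgered manifold is, off the core circles, the standard
picture `P(z, w) = toSphereThree ((Re z + C_k) w̄/|w|, Im z)` (`MMSW.draw`) PRECEDED by a
modification `z ↦ Z_mod(z, w)` of the planar point (`zmod`): the identity where the planar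
potential is `≤ 1 − 3η/2` (`zmod_of_cutoff_eq_zero`), the compression
`c_j + F_j(z, w) u_{c_j}(z)` of the abstract package near the hole `c_j` (`zmod_of_near`: the
first component of `Θᴮ` for the inner collar data of `MMSWPictureCollars`), and, in the far zone,
the compression along the meridians of the outer chart read through the latitude coordinate
(`zmod_of_far`: `Λ_k⁻¹` of the first component of `Θᴮ` for the outer collar data).  The three
régimes are glued by the cutoffs `cutNear`, `cutFar`, whose transition regions lie where the
potential is `< 19/20`, so that no compression takes place there.  We prove the regional formulas
and the smoothness of `Z_mod` on `{w ≠ 0} × {z ∉ poles, |z| < 50(k+1)}` (`contDiffAt_zmod`), and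
introduce the chart point `cpt ζ u` of a (virtual) planar point `ζ` seen from the direction `u`
(`draw_eq_cpt`: the standard picture is `cpt z (w̄/|w|)`).

## References

* R. Kirby, *The Topology of 4-Manifolds*, LNM 1374 (1989), Ch. I §2. [Kirby1989]
* C. Manolescu, M. Marengon, S. Sarkar, M. Willis, Duke Math. J. 172 (2023), Def. 8.26.
  [ManolescuMarengonSarkarWillis2023]
-/

open scoped Manifold ContDiff Topology Real ComplexConjugate
open Function Set

noncomputable section

namespace Literature.Topology.FourManifolds

/-- Local notation: `𝔼 n` is the model Euclidean space `EuclideanSpace ℝ (Fin n)`. -/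
local notation "𝔼 " n:arg => EuclideanSpace ℝ (Fin n)

namespace MMSW

open Literature.AlgebraicTopology.Homotopy.HopfFibration (zC wC)

variable {k : ℕ} {η : ℝ}

/-! ## The localising cutoffs -/

/-- **The near cutoff** `1 − smoothTransition (4(r − 3/2))`: `1` for `r ≤ 3/2`, `0` for `r ≥ 7/4`.
[folklore] -/
def cutNear (r : ℝ) : ℝ := 1 - Real.smoothTransition (4 * (r - 3 / 2))

/-- **The far cutoff** `smoothTransition ((ρ − 16(k+1))/(2(k+1)))`: `0` for `ρ ≤ 16(k+1)`, `1` for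
`ρ ≥ 18(k+1)`. [folklore] -/
def cutFar (k : ℕ) (ρ : ℝ) : ℝ := Real.smoothTransition ((ρ - 16 * ((k : ℝ) + 1)) / (2 * ((k : ℝ) + 1)))

/-- The near cutoff is smooth. [folklore] -/
theorem contDiff_cutNear : ContDiff ℝ ∞ cutNear :=
  contDiff_const.sub (Real.smoothTransition.contDiff.comp (contDiff_const.mul
    (contDiff_id.sub contDiff_const)))

/-- The far cutoff is smooth. [folklore] -/
theorem contDiff_cutFar (k : ℕ) : ContDiff ℝ ∞ (cutFar k) :=
  Real.smoothTransition.contDiff.comp ((contDiff_id.sub contDiff_const).div_const _)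

/-- `cutNear r = 1` for `r ≤ 3/2`. [folklore] -/
theorem cutNear_eq_one {r : ℝ} (hr : r ≤ 3 / 2) : cutNear r = 1 := by
  rw [cutNear, Real.smoothTransition.zero_of_nonpos (by linarith), sub_zero]

/-- `cutNear r = 0` for `r ≥ 7/4`. [folklore] -/
theorem cutNear_eq_zero {r : ℝ} (hr : 7 / 4 ≤ r) : cutNear r = 0 := by
  rw [cutNear, Real.smoothTransition.one_of_one_le (by linarith), sub_self]

/-- `cutFar k ρ = 0` for `ρ ≤ 16(k+1)`. [folklore] -/
theorem cutFar_eq_zero {ρ : ℝ} (hρ : ρ ≤ 16 * ((k : ℝ) + 1)) : cutFar k ρ = 0 :=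
  Real.smoothTransition.zero_of_nonpos (div_nonpos_of_nonpos_of_nonneg (by linarith) (by positivity))

/-- `cutFar k ρ = 1` for `ρ ≥ 18(k+1)`. [folklore] -/
theorem cutFar_eq_one {ρ : ℝ} (hρ : 18 * ((k : ℝ) + 1) ≤ ρ) : cutFar k ρ = 1 := by
  refine Real.smoothTransition.one_of_one_le ?_
  rw [le_div_iff₀ (by positivity)]
  linarith

/-! ## The corrections and the virtual planar point -/

/-- **The inner correction** at the hole `c_j`:
`cutNear |z − c_j| · (F_j(z, w) − |z − c_j|) · u_{c_j}(z)`, `F_j` the compression profile of the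
inner collar data. [folklore] -/
def corrIn (k : ℕ) (η : ℝ) (j : Fin k) (p : ℂ × ℂ) : ℂ :=
  ((cutNear ‖p.1 - holeCentre k j‖ *
      (profF (holeCentre k j) (planarPot k) (cutoff η) p - ‖p.1 - holeCentre k j‖) : ℝ) : ℂ) *
    unitDir (holeCentre k j) p.1

/-- **The outer correction**: `cutFar |z| · (Λ⁻¹ (Θᴮ_out (Λ z, w)).1 − z)`, `Θᴮ_out` the compression
straightening map of the outer collar data in the latitude coordinate `Λ`. [folklore] -/
def corrOut (k : ℕ) (η : ℝ) (p : ℂ × ℂ) : ℂ :=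
  ((cutFar k ‖p.1‖ : ℝ) : ℂ) *
    (latCoordInv k (thetaB 0 (outerPot k) (cutoff η) (latCoord k p.1, p.2)).1 - p.1)

/-- **The virtual planar point** `Z_mod(z, w) = z + Σ_j corrIn_j + corrOut`. [folklore] -/
def zmod (k : ℕ) (η : ℝ) (p : ℂ × ℂ) : ℂ :=
  p.1 + ∑ j : Fin k, corrIn k η j p + corrOut k η p

variable {p : ℂ × ℂ}

/-- `F − |z − c| = χ(g) (ρ(|w|) − |z − c|)`. [folklore] -/
theorem profF_sub_norm (c : ℂ) (ĝ : ℂ → ℝ) (χ : ℝ → ℝ) (p : ℂ × ℂ) :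
    profF c ĝ χ p - ‖p.1 - c‖ = χ (ĝ p.1) * (thinRad ‖p.2‖ - ‖p.1 - c‖) := by
  rw [profF]; ring

/-- Where the cutoff of the potential vanishes the inner corrections vanish. [folklore] -/
theorem corrIn_of_cutoff_eq_zero (j : Fin k) (h : cutoff η (planarPot k p.1) = 0) :
    corrIn k η j p = 0 := by
  rw [corrIn, profF_sub_norm, h]; simp

/-- Far from the hole `c_j` (`|z − c_j| ≥ 7/4`) the `j`-th inner correction vanishes. [folklore] -/
theorem corrIn_of_far_hole (j : Fin k) (h : 7 / 4 ≤ ‖p.1 - holeCentre k j‖) : corrIn k η j p = 0 := by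
  rw [corrIn, cutNear_eq_zero h]; simp

/-- Near the hole `c_j` (`|z − c_j| ≤ 3/2`) the `j`-th inner correction is `(F_j − |z − c_j|) u`.
[folklore] -/
theorem corrIn_of_near_hole (j : Fin k) (h : ‖p.1 - holeCentre k j‖ ≤ 3 / 2) :
    corrIn k η j p = ((profF (holeCentre k j) (planarPot k) (cutoff η) p - ‖p.1 - holeCentre k j‖ :
      ℝ) : ℂ) * unitDir (holeCentre k j) p.1 := by
  rw [corrIn, cutNear_eq_one h, one_mul]

/-- Near the origin (`|z| ≤ 16(k+1)`) the outer correction vanishes. [folklore] -/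
theorem corrOut_of_norm_le (h : ‖p.1‖ ≤ 16 * ((k : ℝ) + 1)) : corrOut k η p = 0 := by
  rw [corrOut, cutFar_eq_zero h]; simp

/-- In the far zone (`|z| ≥ 18(k+1)`) the outer correction is `Λ⁻¹ (Θᴮ_out (Λ z, w)).1 − z`.
[folklore] -/
theorem corrOut_of_far (h : 18 * ((k : ℝ) + 1) ≤ ‖p.1‖) :
    corrOut k η p = latCoordInv k (thetaB 0 (outerPot k) (cutoff η) (latCoord k p.1, p.2)).1 - p.1 := by
  rw [corrOut, cutFar_eq_one h]; simp

/-! ## The three régimes of `Z_mod` -/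

/-- **Near the hole `c_j`** (inner annulus) the virtual point is the first component of the
compression straightening map of the inner collar data: `Z_mod = c_j + F_j u_{c_j}(z)`. [folklore] -/
theorem zmod_of_near {j : Fin k} (hz : p.1 ∈ annulus (holeCentre k j) (1 / 2) (27 / 20)) :
    zmod k η p = (thetaB (holeCentre k j) (planarPot k) (cutoff η) p).1 := by
  classical
  have hk : (0 : ℝ) ≤ k := Nat.cast_nonneg k
  -- the other inner corrections vanish
  have hother : ∀ i : Fin k, i ≠ j → corrIn k η i p = 0 := fun i hi ↦
    corrIn_of_far_hole i (by linarith [norm_sub_holeCentre_ge_of_near hz.2.le hi])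
  -- the outer correction vanishes
  have hout : corrOut k η p = 0 := by
    refine corrOut_of_norm_le ?_
    have h1 : ‖p.1‖ ≤ ‖p.1 - holeCentre k j‖ + ‖holeCentre k j‖ := norm_le_norm_sub_add _ _
    have h2 := norm_holeCentre_le (r := k) j
    linarith [hz.2]
  have hsum : ∑ i : Fin k, corrIn k η i p = corrIn k η j p := by
    rw [Finset.sum_eq_single j (fun i _ hi ↦ hother i hi) (fun h ↦ absurd (Finset.mem_univ j) h)]
  rw [zmod, hsum, hout, add_zero, corrIn_of_near_hole j (by linarith [hz.2]), Complex.ofReal_sub,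
    sub_mul, norm_mul_unitDir]
  simp only [thetaB]
  ring

/-- **In the far zone** the virtual point is `Λ⁻¹` of the first component of the compression
straightening map of the outer collar data. [folklore] -/
theorem zmod_of_far (hz : 18 * ((k : ℝ) + 1) ≤ ‖p.1‖) :
    zmod k η p = latCoordInv k (thetaB 0 (outerPot k) (cutoff η) (latCoord k p.1, p.2)).1 := by
  have hk : (0 : ℝ) ≤ k := Nat.cast_nonneg k
  have hin : ∀ j : Fin k, corrIn k η j p = 0 := fun j ↦ by
    refine corrIn_of_far_hole j ?_
    have h1 := norm_sub_norm_le p.1 (holeCentre k j)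
    have h2 := norm_holeCentre_le (r := k) j
    linarith
  rw [zmod, Finset.sum_eq_zero fun j _ ↦ hin j, add_zero, corrOut_of_far hz]
  ring

/-- `y = 0` forces the focus: `coLat k z = 0 → z = a − C_k` (for `Re z + C_k ≥ 0`). [folklore] -/
theorem eq_focus_of_coLat_eq_zero {z : ℂ} (hρ : 0 ≤ z.re + drawRadius k) (h : coLat k z = 0) :
    z = ((focal k - drawRadius k : ℝ) : ℂ) := by
  have h0 : coLat k z 0 = 0 := by rw [h]; rfl
  have h1 : coLat k z 1 = 0 := by rw [h]; rfl
  have hS := outerDen_pos (k := k) z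
  have ha := focal_pos (k := k)
  rw [coLat_apply_zero, div_eq_zero_iff] at h0
  rw [coLat_apply_one, div_eq_zero_iff] at h1
  have him : z.im = 0 := by
    rcases h0 with h0 | h0
    · have : 2 * focal k ≠ 0 := by positivity
      exact (mul_eq_zero.1 h0).resolve_left this
    · linarith
  have hre : (z.re + drawRadius k) ^ 2 = focal k ^ 2 := by
    rcases h1 with h1 | h1
    · rw [him] at h1; nlinarith
    · linarith
  have hre' : z.re + drawRadius k = focal k := by
    have hprod : (z.re + drawRadius k - focal k) * (z.re + drawRadius k + focal k) = 0 := by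
      linear_combination hre
    rcases mul_eq_zero.1 hprod with h' | h'
    · linarith
    · linarith
  apply Complex.ext
  · simp only [Complex.ofReal_re]; linarith
  · simp only [Complex.ofReal_im]; exact him

/-- The focus lies well inside: `|a − C_k| < 9(k+1)`. [folklore] -/
theorem norm_focus_lt : ‖((focal k - drawRadius k : ℝ) : ℂ)‖ < 9 * ((k : ℝ) + 1) := by
  have h1 := lt_focal (k := k)
  have h2 := focal_lt_drawRadius (k := k)
  rw [Complex.norm_real, Real.norm_eq_abs, abs_of_neg (by linarith)]
  unfold drawRadius; linarith

/-- **Where the cutoff of the potential vanishes** (`|z| < C_k`) there is no compression: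
`Z_mod(z, w) = z`. [folklore] -/
theorem zmod_of_cutoff_eq_zero (h : cutoff η (planarPot k p.1) = 0) (hz : ‖p.1‖ < drawRadius k) :
    zmod k η p = p.1 := by
  have hk : (0 : ℝ) ≤ k := Nat.cast_nonneg k
  have hρ : 0 < p.1.re + drawRadius k := by
    have := (Complex.abs_re_le_norm p.1)
    have := neg_abs_le p.1.re
    linarith
  rw [zmod, Finset.sum_eq_zero fun j _ ↦ corrIn_of_cutoff_eq_zero j h, add_zero, corrOut]
  by_cases hco : coLat k p.1 = 0
  · -- at the focus the far cutoff vanishes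
    have hfoc := eq_focus_of_coLat_eq_zero hρ.le hco
    have hsmall : ‖p.1‖ ≤ 16 * ((k : ℝ) + 1) := by
      rw [hfoc]; linarith [norm_focus_lt (k := k)]
    rw [cutFar_eq_zero hsmall]; simp
  · -- off the focus: `outerPot (Λ z) = g z`, so the outer profile is `|Λ z|` and `Λ⁻¹ Λ z = z`
    have hs : 0 < latS k p.1 := div_pos (mul_pos (mul_pos two_pos focal_pos) hρ) (outerDen_pos _)
    have hpot : outerPot k (latCoord k p.1) = planarPot k p.1 := outerPot_latCoord hco hs
    have hprof : profF 0 (outerPot k) (cutoff η) (latCoord k p.1, p.2) = ‖latCoord k p.1‖ := by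
      rw [profF]
      simp only [hpot, h, sub_zero]
      ring
    have hfst : (thetaB 0 (outerPot k) (cutoff η) (latCoord k p.1, p.2)).1 = latCoord k p.1 := by
      rw [thetaB]
      simp only [hprof, zero_add]
      have := norm_mul_unitDir 0 (latCoord k p.1)
      simp only [sub_zero] at this
      exact this
    rw [hfst, latCoordInv_latCoord hco hs, sub_self, mul_zero, add_zero]

/-! ## Smoothness of the virtual point -/

/-- The inner corrections are smooth on `{w ≠ 0} × {z ∉ poles}`. [folklore] -/
theorem contDiffAt_corrIn (j : Fin k) (hw : p.2 ≠ 0) (hz : ∀ i : Fin k, p.1 ≠ holeCentre k i) :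
    ContDiffAt ℝ ∞ (corrIn k η j) p := by
  have hzj : p.1 ≠ holeCentre k j := hz j
  have hnorm : ContDiffAt ℝ ∞ (fun p : ℂ × ℂ ↦ ‖p.1 - holeCentre k j‖) p :=
    (contDiffAt_fst.sub contDiffAt_const).norm ℝ (sub_ne_zero.2 hzj)
  have hg : ContDiffAt ℝ ∞ (fun p : ℂ × ℂ ↦ planarPot k p.1) p :=
    (contDiffAt_planarPot hz).comp p contDiffAt_fst
  have hχ : ContDiffAt ℝ ∞ (fun p : ℂ × ℂ ↦ cutoff η (planarPot k p.1)) p :=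
    (contDiff_cutoff η).contDiffAt.comp p hg
  have hρ : ContDiffAt ℝ ∞ (fun p : ℂ × ℂ ↦ thinRad ‖p.2‖) p :=
    contDiff_thinRad.contDiffAt.comp p (contDiffAt_snd.norm ℝ hw)
  have hF : ContDiffAt ℝ ∞ (profF (holeCentre k j) (planarPot k) (cutoff η)) p := by
    unfold profF
    exact (hχ.mul hρ).add ((contDiffAt_const.sub hχ).mul hnorm)
  have hu : ContDiffAt ℝ ∞ (fun p : ℂ × ℂ ↦ unitDir (holeCentre k j) p.1) p :=
    (contDiffAt_unitDir hzj).comp p contDiffAt_fst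
  unfold corrIn
  exact (Complex.ofRealCLM.contDiff.comp_contDiffAt p
    ((contDiff_cutNear.contDiffAt.comp p hnorm).mul (hF.sub hnorm))).mul hu

/-- On `|z| < C_k` the latitude is positive; off the focus it is `< 1`. [folklore] -/
theorem latS_pos_of_norm_lt {z : ℂ} (hz : ‖z‖ < drawRadius k) : 0 < latS k z := by
  have hρ : 0 < z.re + drawRadius k := by
    have := Complex.abs_re_le_norm z
    have := neg_abs_le z.re
    linarith
  exact div_pos (mul_pos (mul_pos two_pos focal_pos) hρ) (outerDen_pos _)

/-- Off the focus the latitude is `< 1`. [folklore] -/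
theorem latS_lt_one_of_coLat_ne_zero {z : ℂ} (hz : coLat k z ≠ 0) : latS k z < 1 := by
  have h := latS_sq_add_norm_coLat_sq (k := k) z
  have hn : 0 < ‖coLat k z‖ := norm_pos_iff.2 hz
  have h1 := latS_le_one (k := k) z
  nlinarith

/-- `|z| > 15(k+1)` excludes the focus. [folklore] -/
theorem coLat_ne_zero_of_lt_norm {z : ℂ} (hz : 15 * ((k : ℝ) + 1) < ‖z‖) (hz' : ‖z‖ < drawRadius k) :
    coLat k z ≠ 0 := by
  intro h
  have hρ : 0 ≤ z.re + drawRadius k := by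
    have := Complex.abs_re_le_norm z
    have := neg_abs_le z.re
    linarith
  have hfoc := eq_focus_of_coLat_eq_zero hρ h
  rw [hfoc] at hz
  linarith [norm_focus_lt (k := k)]

/-- The outer correction is smooth on `{w ≠ 0} × {z ∉ poles, |z| < 50(k+1)}`. [folklore] -/
theorem contDiffAt_corrOut (hw : p.2 ≠ 0) (hz : ∀ i : Fin k, p.1 ≠ holeCentre k i)
    (hz' : ‖p.1‖ < 50 * ((k : ℝ) + 1)) : ContDiffAt ℝ ∞ (corrOut k η) p := by
  have hk : (0 : ℝ) ≤ k := Nat.cast_nonneg k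
  have hzC : ‖p.1‖ < drawRadius k := by unfold drawRadius; linarith
  by_cases hsmall : ‖p.1‖ < 16 * ((k : ℝ) + 1)
  · -- locally zero
    have hev : (fun _ : ℂ × ℂ ↦ (0 : ℂ)) =ᶠ[𝓝 p] corrOut k η := by
      have ho : IsOpen {q : ℂ × ℂ | ‖q.1‖ < 16 * ((k : ℝ) + 1)} :=
        isOpen_lt (continuous_norm.comp continuous_fst) continuous_const
      filter_upwards [ho.mem_nhds hsmall] with q hq
      exact (corrOut_of_norm_le hq.le).symm
    exact contDiffAt_const.congr_of_eventuallyEq hev.symm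
  · push Not at hsmall
    have hco : coLat k p.1 ≠ 0 := coLat_ne_zero_of_lt_norm (by linarith) hzC
    have hs : 0 < latS k p.1 := latS_pos_of_norm_lt hzC
    have hs1 : latS k p.1 < 1 := latS_lt_one_of_coLat_ne_zero hco
    -- the latitude coordinate
    have hΛ : ContDiffAt ℝ ∞ (fun q : ℂ × ℂ ↦ latCoord k q.1) p :=
      (contDiffAt_latCoord hco).comp p contDiffAt_fst
    have hq0 : latCoord k p.1 ≠ 0 := by
      intro h0
      have := norm_latCoord hco hs.le
      rw [h0, norm_zero] at this
      linarith
    have hq1 : ‖latCoord k p.1‖ < 1 := by rw [norm_latCoord hco hs.le]; exact hs1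
    -- the outer straightening map at `(Λ z, w)`
    have hpot : ContDiffAt ℝ ∞ (outerPot k) (latCoord k p.1) := by
      have hpl : ContDiffAt ℝ ∞ (planarPot k) (latCoordInv k (latCoord k p.1)) := by
        rw [latCoordInv_latCoord hco hs]
        exact contDiffAt_planarPot hz
      exact hpl.comp (latCoord k p.1) (contDiffAt_latCoordInv hq0 hq1)
    have hθ : ContDiffAt ℝ ∞ (thetaB 0 (outerPot k) (cutoff η)) (latCoord k p.1, p.2) :=
      contDiffAt_thetaB (p := (latCoord k p.1, p.2)) hq0 hw hpot (contDiff_cutoff η)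
    have hθ' : ContDiffAt ℝ ∞ ((thetaB 0 (outerPot k) (cutoff η)) ∘
        (fun q : ℂ × ℂ ↦ (latCoord k q.1, q.2))) p :=
      hθ.comp p (hΛ.prodMk contDiffAt_snd)
    -- its first component stays in the punctured unit disc
    have hF : 0 < profF 0 (outerPot k) (cutoff η) (latCoord k p.1, p.2) :=
      profF_pos (p := (latCoord k p.1, p.2)) hq0 hw (cutoff_nonneg _ _) (cutoff_le_one _ _)
    have hF1 : profF 0 (outerPot k) (cutoff η) (latCoord k p.1, p.2) < 1 := by
      have hχ0 := cutoff_nonneg η (outerPot k (latCoord k p.1))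
      have hχ1 := cutoff_le_one η (outerPot k (latCoord k p.1))
      have hρ := thinRad_lt_half ‖p.2‖
      rw [profF]
      simp only [sub_zero]
      rw [norm_latCoord hco hs.le]
      nlinarith
    have hnorm1 : ‖(thetaB 0 (outerPot k) (cutoff η) (latCoord k p.1, p.2)).1‖ =
        profF 0 (outerPot k) (cutoff η) (latCoord k p.1, p.2) := by
      rw [← sub_zero (thetaB 0 (outerPot k) (cutoff η) (latCoord k p.1, p.2)).1,
        norm_thetaB_fst_sub (p := (latCoord k p.1, p.2)) hq0 hF.le]
    have hfst0 : (thetaB 0 (outerPot k) (cutoff η) (latCoord k p.1, p.2)).1 ≠ 0 := by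
      intro h0; rw [h0, norm_zero] at hnorm1; linarith
    have hfst1 : ‖(thetaB 0 (outerPot k) (cutoff η) (latCoord k p.1, p.2)).1‖ < 1 := by
      rw [hnorm1]; exact hF1
    have hinv : ContDiffAt ℝ ∞ (latCoordInv k ∘ Prod.fst ∘ ((thetaB 0 (outerPot k) (cutoff η)) ∘
        (fun q : ℂ × ℂ ↦ (latCoord k q.1, q.2)))) p :=
      (contDiffAt_latCoordInv hfst0 hfst1).comp p (contDiffAt_fst.comp p hθ')
    have hz0 : p.1 ≠ 0 := by
      rw [← norm_pos_iff]; linarith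
    have hcut : ContDiffAt ℝ ∞ (fun q : ℂ × ℂ ↦ ((cutFar k ‖q.1‖ : ℝ) : ℂ)) p :=
      Complex.ofRealCLM.contDiff.comp_contDiffAt p ((contDiff_cutFar k).contDiffAt.comp p
        (contDiffAt_fst.norm ℝ hz0))
    have hfun : corrOut k η = fun q : ℂ × ℂ ↦ ((cutFar k ‖q.1‖ : ℝ) : ℂ) *
        ((latCoordInv k ∘ Prod.fst ∘ ((thetaB 0 (outerPot k) (cutoff η)) ∘
          (fun q : ℂ × ℂ ↦ (latCoord k q.1, q.2)))) q - q.1) := rfl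
    rw [hfun]
    exact hcut.mul (hinv.sub contDiffAt_fst)

/-- **Smoothness of the virtual point** on `{w ≠ 0} × {z ∉ poles, |z| < 50(k+1)}`. [folklore] -/
theorem contDiffAt_zmod (hw : p.2 ≠ 0) (hz : ∀ i : Fin k, p.1 ≠ holeCentre k i)
    (hz' : ‖p.1‖ < 50 * ((k : ℝ) + 1)) : ContDiffAt ℝ ∞ (zmod k η) p := by
  unfold zmod
  exact (contDiffAt_fst.add (ContDiffAt.sum fun j _ ↦ contDiffAt_corrIn j hw hz)).add
    (contDiffAt_corrOut hw hz hz')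

/-! ## The chart point of a virtual planar point -/

/-- **The chart point** of the planar point `ζ` seen from the direction `u ∈ 𝕊¹ ⊆ ℂ`:
planar position `(Re ζ + C_k) u`, height `Im ζ`. [folklore] -/
def cpt (k : ℕ) (ζ u : ℂ) : (ℝ × ℝ) × ℝ :=
  (((((ζ.re + drawRadius k : ℝ) : ℂ) * u).re, ((((ζ.re + drawRadius k : ℝ) : ℂ) * u).im)), ζ.im)

/-- The direction `w̄/|w|` of the standard picture as the conjugate of the unit radial field.
[folklore] -/
theorem conj_unitDir_zero (w : ℂ) : conj (unitDir 0 w) = conj w / ((‖w‖ : ℝ) : ℂ) := by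
  rw [unitDir, sub_zero, map_mul, Complex.conj_ofReal, div_eq_inv_mul, Complex.ofReal_inv]

/-- **The standard picture is the chart point of `z` seen from `w̄/|w|`.** [folklore] -/
theorem draw_eq_cpt (x : 𝔼 4) : draw k x = cpt k (zC x) (conj (unitDir 0 (wC x))) := by
  rw [draw, cpt, conj_unitDir_zero, ← mul_div_assoc]
  rfl

/-- The planar point of `cpt ζ u` is `(Re ζ + C_k) u`. [folklore] -/
theorem chartC_cpt (ζ u : ℂ) : chartC (cpt k ζ u) = ((ζ.re + drawRadius k : ℝ) : ℂ) * u := by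
  apply Complex.ext <;> simp [chartC, cpt]

/-- `cpt` reads back: `chartZ (cpt ζ u) = ζ` for a unit vector `u` and `Re ζ + C_k ≥ 0`. [folklore] -/
theorem chartZ_cpt {ζ u : ℂ} (hu : ‖u‖ = 1) (hζ : 0 ≤ ζ.re + drawRadius k) : chartZ k (cpt k ζ u) = ζ := by
  apply Complex.ext
  · rw [chartZ_re, chartC_cpt, norm_mul, Complex.norm_real, Real.norm_of_nonneg hζ, hu, mul_one,
      add_sub_cancel_right]
  · rw [chartZ_im]; rfl

/-- `cpt` is smooth in `(ζ, u)`. [folklore] -/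
theorem contDiff_cpt (k : ℕ) : ContDiff ℝ ∞ fun q : ℂ × ℂ ↦ cpt k q.1 q.2 := by
  have hre : ContDiff ℝ ∞ fun z : ℂ ↦ z.re := Complex.reCLM.contDiff
  have him : ContDiff ℝ ∞ fun z : ℂ ↦ z.im := Complex.imCLM.contDiff
  have hprod : ContDiff ℝ ∞ fun q : ℂ × ℂ ↦ (((q.1.re + drawRadius k : ℝ) : ℂ) * q.2) :=
    (Complex.ofRealCLM.contDiff.comp ((hre.comp contDiff_fst).add contDiff_const)).mul contDiff_snd
  unfold cpt
  exact ((hre.comp hprod).prodMk (him.comp hprod)).prodMk (him.comp contDiff_fst)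

/-! ## No return: a compressed virtual point never has small potential -/

/-- The compression profile is a convex combination of `ρ(|w|)` and `|z − c|`: if `ρ(|w|) ≤ |z − c|`
it lies between them. [folklore] -/
theorem profF_mem_Icc {c : ℂ} {ĝ : ℂ → ℝ} {χ : ℝ → ℝ} (hχ0 : 0 ≤ χ (ĝ p.1)) (hχ1 : χ (ĝ p.1) ≤ 1)
    (h : thinRad ‖p.2‖ ≤ ‖p.1 - c‖) : profF c ĝ χ p ∈ Icc (thinRad ‖p.2‖) ‖p.1 - c‖ := by
  rw [profF]
  constructor <;> nlinarith

/-- The potential along an outer meridian is strictly decreasing across the band. [folklore] -/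
theorem planarPot_outerZ_strictAntiOn {e : 𝔼 2} (he : ‖e‖ = 1) :
    StrictAntiOn (fun s : ℝ ↦ planarPot k (outerZ k e s)) (outerBand k) := by
  have hd : ∀ s ∈ outerBand k, ∃ d : ℝ,
      HasDerivAt (fun s : ℝ ↦ planarPot k (outerZ k e s)) d s ∧ d ≤ -2 := fun s hs ↦
    exists_hasDerivAt_planarPot_outerZ he hs
  refine strictAntiOn_of_deriv_neg (convex_Icc _ _) (fun s hs ↦
    (hd s hs).choose_spec.1.continuousAt.continuousWithinAt) fun s hs ↦ ?_
  obtain ⟨d, hds, hdle⟩ := hd s (interior_subset hs)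
  rw [hds.deriv]; linarith

/-- In the far zone the virtual point is the meridian point `Z_k(ê, F)` of the outer profile
`F = χ(g) ρ(|w|) + (1 − χ(g)) s_k(z)`, `ê = y/|y|`. [folklore] -/
theorem zmod_of_far_eq_outerZ (hz : 18 * ((k : ℝ) + 1) ≤ ‖p.1‖) (hz' : ‖p.1‖ < drawRadius k)
    (hw : p.2 ≠ 0) :
    zmod k η p = outerZ k (coLatDir k p.1)
      (cutoff η (planarPot k p.1) * thinRad ‖p.2‖ + (1 - cutoff η (planarPot k p.1)) * latS k p.1) ∧
    0 < cutoff η (planarPot k p.1) * thinRad ‖p.2‖ + (1 - cutoff η (planarPot k p.1)) * latS k p.1 := by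
  have hk : (0 : ℝ) ≤ k := Nat.cast_nonneg k
  have hco : coLat k p.1 ≠ 0 := coLat_ne_zero_of_lt_norm (by linarith) hz'
  have hs : 0 < latS k p.1 := latS_pos_of_norm_lt hz'
  have hpot : outerPot k (latCoord k p.1) = planarPot k p.1 := outerPot_latCoord hco hs
  have hq0 : latCoord k p.1 ≠ 0 := by
    intro h0; have := norm_latCoord hco hs.le; rw [h0, norm_zero] at this; linarith
  -- the outer profile
  have hF : profF 0 (outerPot k) (cutoff η) (latCoord k p.1, p.2) =
      cutoff η (planarPot k p.1) * thinRad ‖p.2‖ + (1 - cutoff η (planarPot k p.1)) * latS k p.1 := by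
    rw [profF]; simp only [hpot, sub_zero]; rw [norm_latCoord hco hs.le]
  have hFpos : 0 < profF 0 (outerPot k) (cutoff η) (latCoord k p.1, p.2) :=
    profF_pos (p := (latCoord k p.1, p.2)) hq0 hw (cutoff_nonneg _ _) (cutoff_le_one _ _)
  refine ⟨?_, hF ▸ hFpos⟩
  rw [zmod_of_far hz, thetaB, latCoordInv]
  simp only
  rw [unitDir_latCoord hco hs]
  have hu : ‖toC (coLatDir k p.1)‖ = 1 := by rw [norm_toC, norm_coLatDir hco]
  rw [unitDir_ray hu hFpos, toE2_toC, zero_add, norm_mul, Complex.norm_real, hu, mul_one,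
    Real.norm_of_nonneg hFpos.le, hF]

/-- Near the hole `c_j` the virtual point is the ray point `c_j + F u_{c_j}(z)` of the inner profile
`F = χ(g) ρ(|w|) + (1 − χ(g)) |z − c_j|`. [folklore] -/
theorem zmod_of_near_eq_ray {j : Fin k} (hz : p.1 ∈ annulus (holeCentre k j) (1 / 2) (27 / 20)) :
    zmod k η p = holeCentre k j + (((cutoff η (planarPot k p.1) * thinRad ‖p.2‖ +
      (1 - cutoff η (planarPot k p.1)) * ‖p.1 - holeCentre k j‖ : ℝ) : ℂ)) *
        unitDir (holeCentre k j) p.1 := by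
  rw [zmod_of_near hz, thetaB, profF]

/-- **No return.**  If the potential of `z` is off the lower plateau of the cutoff (so that a
compression may take place), the virtual point `Z_mod(z, w)` has potential `> 1 − 3η/2` as well:
compression moves the virtual point towards the poles / the outer end, where the potential only
increases (`0 < η ≤ 1/40`, `z` guarded, `g(z) ≤ 1`, `|z| ≤ 40(k+1)`, `w ≠ 0`). [folklore] -/
theorem lt_planarPot_zmod (hη : 0 < η) (hη' : η ≤ 1 / 40)
    (hguard : ∀ j : Fin k, 1 ≤ ‖p.1 - holeCentre k j‖) (hg1 : planarPot k p.1 ≤ 1)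
    (hz : ‖p.1‖ ≤ 40 * ((k : ℝ) + 1)) (hw : p.2 ≠ 0) (hχ : cutoff η (planarPot k p.1) ≠ 0) :
    1 - 3 * η / 2 < planarPot k (zmod k η p) := by
  have hk : (0 : ℝ) ≤ k := Nat.cast_nonneg k
  have hg : 1 - 3 * η / 2 < planarPot k p.1 := lt_of_cutoff_ne_zero hη hχ
  have h1920 : 19 / 20 ≤ planarPot k p.1 := by linarith
  have hχ0 := cutoff_nonneg η (planarPot k p.1)
  have hχ1 := cutoff_le_one η (planarPot k p.1)
  have hρ := thinRad_lt_half ‖p.2‖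
  have hρ0 : 0 < thinRad ‖p.2‖ := thinRad_pos (norm_pos_iff.2 hw)
  rcases far_or_near_of_le_planarPot h1920 with hfar | ⟨j, hj⟩
  · -- the far zone
    rw [bigRadius] at hfar
    have h20 : 20 * ((k : ℝ) + 1) ≤ ‖p.1‖ := by linarith
    have hzC : ‖p.1‖ < drawRadius k := by unfold drawRadius; linarith
    obtain ⟨hzmod, hFpos⟩ := zmod_of_far_eq_outerZ (η := η) (by linarith) hzC hw
    rw [hzmod]
    have hco : coLat k p.1 ≠ 0 := coLat_ne_zero_of_lt_norm (by linarith) hzC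
    have he : ‖coLatDir k p.1‖ = 1 := norm_coLatDir hco
    obtain ⟨hs1, hs2⟩ := latS_mem_of_far h20 hg1 h1920
    have hc1 := lt_latC (k := k)
    set F := cutoff η (planarPot k p.1) * thinRad ‖p.2‖ +
      (1 - cutoff η (planarPot k p.1)) * latS k p.1 with hFdef
    by_cases hFc : F < latC k
    · have := one_lt_planarPot_outerZ he hFpos hFc
      linarith
    · push Not at hFc
      -- `F ≤ s_k(z)` and both lie in the band: monotonicity of the meridian potential
      have hFs : F ≤ latS k p.1 := by rw [hFdef]; nlinarith
      have hFb : F ∈ outerBand k := ⟨by linarith, by linarith⟩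
      have hsb : latS k p.1 ∈ outerBand k := ⟨by linarith, by linarith⟩
      have hmono : planarPot k (outerZ k (coLatDir k p.1) (latS k p.1)) ≤
          planarPot k (outerZ k (coLatDir k p.1) F) :=
        (planarPot_outerZ_strictAntiOn (k := k) he).antitoneOn hFb hsb hFs
      rw [outerZ_coLatDir_latS] at hmono
      linarith
  · -- near the hole `c_j`
    have hr1 : 1 ≤ ‖p.1 - holeCentre k j‖ := hguard j
    have hann : p.1 ∈ annulus (holeCentre k j) (1 / 2) (27 / 20) := ⟨by linarith, hj⟩
    rw [zmod_of_near_eq_ray hann]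
    set F := cutoff η (planarPot k p.1) * thinRad ‖p.2‖ +
      (1 - cutoff η (planarPot k p.1)) * ‖p.1 - holeCentre k j‖ with hFdef
    have hu : ‖unitDir (holeCentre k j) p.1‖ = 1 :=
      norm_unitDir (ne_centre_of_mem_annulus (by norm_num) hann)
    have hF0 : 0 < F := by rw [hFdef]; nlinarith
    have hFr : F ≤ ‖p.1 - holeCentre k j‖ := by rw [hFdef]; nlinarith
    have hne : holeCentre k j + ((F : ℝ) : ℂ) * unitDir (holeCentre k j) p.1 ≠ holeCentre k j := by
      intro h
      have h' : ((F : ℝ) : ℂ) * unitDir (holeCentre k j) p.1 = 0 := by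
        have := congrArg (· - holeCentre k j) h
        simpa using this
      rcases mul_eq_zero.1 h' with h'' | h''
      · exact hF0.ne' (by exact_mod_cast h'')
      · rw [← norm_eq_zero, hu] at h''; exact one_ne_zero h''
    by_cases hF1 : F ≤ 1
    · have := one_le_planarPot_of_norm_le_one hne (by
        rw [add_sub_cancel_left, norm_mul, Complex.norm_real, Real.norm_of_nonneg hF0.le, hu,
          mul_one]; exact hF1)
      linarith
    · push Not at hF1
      have hmono : planarPot k (holeCentre k j + ‖p.1 - holeCentre k j‖ • unitDir (holeCentre k j) p.1) ≤
          planarPot k (holeCentre k j + F • unitDir (holeCentre k j) p.1) :=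
        (planarPot_ray_strictAntiOn (k := k) j hu).antitoneOn
          (a := F) (b := ‖p.1 - holeCentre k j‖) ⟨hF0, by linarith⟩ ⟨by linarith, hj.le⟩ hFr
      rw [Complex.real_smul, Complex.real_smul, norm_mul_unitDir, add_sub_cancel] at hmono
      linarith

end MMSW

end Literature.Topology.FourManifolds
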